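import Literature.Analysis.FluidPDE.TaoCascadeScaleOneSmall
import Literature.Analysis.FluidPDE.TaoCascadeZeroScaleGrowth
import HarnessLib

/-!
# Tao's cascade ODE, proof of Prop. 6.5 — Prop. 6.13, II: `b₁` and the rotor phase on the past

T. Tao, *Finite time blowup for an averaged three-dimensional Navier–Stokes equation*,
J. Amer. Math. Soc. 29 (2016), 601–674 (arXiv:1402.0290v3), §6.6 Prop. 6.13, displays (6.123)–(6.125)
of arXiv v3 ("In a similar spirit, from (6.46) one has `|∂ₜb₁| ≤ εa₁² + ε⁻¹K^{10}c₁² + O(…)` … hence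
`|b₁(t)| ≲ K^{-30}ε/(1+|t|²)` for `τ_{n₀-N} ≤ t ≤ 0`, and (6.125) `|b₁(t)| ≲ K^{-1/4}ε` for
`0 ≤ t ≤ τ'`"), in the repaired form of `TaoCascadeScaleOnePast.lean` / `TaoCascadeScaleOneSmall.lean`.

Setting: `h : RescaledHypotheses γ …`, `τ₀ = τ_{n₀-N}`, `b₁ = Y 1 1`, `c₁ = Y 2 1`, the rotor phase
`Λ(t) = ∫_{τ₀}^t |b₁|` with bootstrap bound `Λ ≤ ε/100` on `[τ₀, T]`, and an abstract **past source
level** `S₀`: `∫_{τ₀}^t R ≤ S₀ (1+ε₀)^{(496/100)k}` on the `k`-th past interval (supplied by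
`integral_source_one_past_le`). Then (all constants explicit):

* `abs_c_one_past_le` — `|c₁| ≤ e^{(6/100)K^{10}} S₀ (1+ε₀)^{(496/100)k}` on the `k`-th past interval;
* `abs_b_one_le_integral` — `|b₁(t)| ≤ ∫_{τ₀}^t R_b`, `R_b = (1+ε₀)^{5/2}(εa₁² + ε⁻¹K^{10}c₁²) + 4C₁δẼ₁^{1/2}`;
* `integral_sq_c_one_past_le` — `∫_{τ₀}^t c₁² ≤ (e^{(6/100)K^{10}}S₀)² C₃ geomConst(741/100) (1+ε₀)^{(741/100)k}`
  (the time-frozen extension `s ↦ c₁(min s t)` makes the piecewise bound global, so that the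
  summation lemma `integral_past_le` applies);
* `integral_source_b_one_past_le`, `abs_b_one_past_le` — (6.123)–(6.124) repaired:
  `|b₁| ≤ ∫R_b ≤ D_b (1+ε₀)^{(496/100)k}` on the `k`-th past interval, `D_b = 12εK^{-30}C₃G_{747} + 6ε⁻¹K^{10}(e^{(6/100)K^{10}}S₀)²C₃G_{741} + 4C₁δ Ξ C₃ G_{496}`;
* `rotorPhase_past_le` — `Λ(t) ≤ D_b C₃ geomConst(245/100)` for past times `t`.

The closing of the bootstrap and the bounds at positive times are in `TaoCascadeScaleOneClose.lean`.

## References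

* T. Tao, arXiv:1402.0290v3, §6.6 Prop. 6.13, (6.121)–(6.125). [`Tao2016AveragedNS`]
-/

noncomputable section

open Set MeasureTheory intervalIntegral Filter Topology
open Literature.Analysis.ODE

namespace Literature.Analysis.FluidPDE

namespace TaoCascade

/-! ## Two tools: time-frozen extensions and the ordering of the past intervals -/

/-- Continuity of the time-frozen extension `s ↦ f (min s t)` of a function continuous on `[a, b]`,
`t ∈ [a, b]`, on any `[a, b']`. [folklore] -/
theorem continuousOn_comp_min {f : ℝ → ℝ} {a b t b' : ℝ} (hf : ContinuousOn f (Icc a b))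
    (ht : t ∈ Icc a b) : ContinuousOn (fun s => f (min s t)) (Icc a b') := by
  refine hf.comp (continuous_id.min continuous_const).continuousOn fun s hs => ?_
  exact ⟨le_min hs.1 ht.1, (min_le_right _ _).trans ht.2⟩

section Past

variable {γ ε₀ K ε C₁ C₂ C₃ : ℝ} {n₀ N : ℤ} {τ : ℤ → ℝ} {Xr : Fin 4 → ℤ → ℝ → ℝ} {Er : ℤ → ℝ → ℝ}

/-- **Ordering of the past intervals**: if `t` lies in the `k`-th and `s` in the `j`-th past interval
and `t < s`, then `k ≤ j`. [cite: Tao2016AveragedNS, §6.4 Prop. 6.5 (vii)] -/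
theorem RescaledHypotheses.piece_index_le (h : RescaledHypotheses γ ε₀ K ε C₁ C₂ C₃ n₀ N τ Xr Er)
    {j k : ℤ} (hj1 : n₀ - N < j) (hk0 : k ≤ 0) {s t : ℝ}
    (hs : s ∈ Icc (τ (j - 1)) (τ j)) (ht : t ∈ Icc (τ (k - 1)) (τ k)) (hts : t < s) : k ≤ j := by
  by_contra hcon
  push Not at hcon
  have hmono : τ j ≤ τ (k - 1) := h.tau_mono (by omega) (by omega) (by omega)
  linarith [hs.2, ht.1]

/-- Monotonicity of the decay factors in the scale: `(1+ε₀)^{r k} ≤ (1+ε₀)^{r j}` for `k ≤ j`,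
`r ≥ 0`, `ε₀ ≥ 0`. [folklore] -/
theorem rpow_scale_mono {ε₀ r : ℝ} (hε₀ : 0 ≤ ε₀) (hr : 0 ≤ r) {k j : ℤ} (hkj : k ≤ j) :
    (1 + ε₀) ^ (r * k) ≤ (1 + ε₀) ^ (r * j) := by
  apply Real.rpow_le_rpow_of_exponent_le (by linarith)
  have : (k : ℝ) ≤ j := by exact_mod_cast hkj
  nlinarith

/-- Comparison of two decay rates on the past: `(1+ε₀)^{r k} ≤ (1+ε₀)^{r' k}` for `k ≤ 0`, `r' ≤ r`.
[folklore] -/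
theorem rpow_rate_mono {ε₀ r r' : ℝ} (hε₀ : 0 ≤ ε₀) (hrr : r' ≤ r) {k : ℤ} (hk : k ≤ 0) :
    (1 + ε₀) ^ (r * k) ≤ (1 + ε₀) ^ (r' * k) := by
  apply Real.rpow_le_rpow_of_exponent_le (by linarith)
  have : (k : ℝ) ≤ 0 := by exact_mod_cast hk
  nlinarith

/-! ## `c₁` on the past intervals -/

/-- **`c₁` on the `k`-th past interval.** Under the bootstrap bound `Λ ≤ ε/100` on `[τ₀, T]` and a
past source level `S₀` (`∫_{τ₀}^t R ≤ S₀(1+ε₀)^{(496/100)k}` on the `k`-th interval), for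
`t ≤ T` in the `k`-th past interval: `|c₁(t)| ≤ e^{(6/100)K^{10}} S₀ (1+ε₀)^{(496/100)k}`.
[cite: Tao2016AveragedNS, §6.6 Prop. 6.13 (6.122)–(6.123)] -/
theorem RescaledHypotheses.abs_c_one_past_le
    (h : RescaledHypotheses γ ε₀ K ε C₁ C₂ C₃ n₀ N τ Xr Er) (hε₀ : 0 < ε₀) (hε₀1 : ε₀ < 1)
    (hε : 0 < ε) (hC₁ : 0 ≤ C₁) (hN : n₀ ≤ N) {T S₀ : ℝ}
    (hΛ : ∀ t ∈ Icc (τ (n₀ - N)) T, ∫ s in (τ (n₀ - N))..t, |Xr 1 1 s| ≤ ε / 100)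
    (hS₀ : ∀ k, n₀ - N < k → k ≤ 0 → ∀ t ∈ Icc (τ (k - 1)) (τ k),
      ∫ s in (τ (n₀ - N))..t, ((1 + ε₀) ^ ((5 : ℝ) / 2) * ε ^ 2 * Real.exp (-K ^ 10) * Xr 0 1 s ^ 2 +
        4 * C₁ * (1 + ε₀) ^ (-(n₀ : ℝ) / 2) * Real.sqrt (Er 1 s)) ≤
        S₀ * (1 + ε₀) ^ ((496 : ℝ) / 100 * k))
    {k : ℤ} (hk : n₀ - N < k) (hk0 : k ≤ 0) {t : ℝ} (ht : t ∈ Icc (τ (k - 1)) (τ k)) (htT : t ≤ T) :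
    |Xr 2 1 t| ≤ Real.exp (6 / 100 * K ^ 10) * S₀ * (1 + ε₀) ^ ((496 : ℝ) / 100 * k) := by
  have hτt : τ (n₀ - N) ≤ t := (h.tau_init_le_tau (by omega) (by omega)).trans ht.1
  have h1 := h.abs_c_one_le_exp_mul_integral hε₀ hε₀1 hε hC₁ hN hΛ ⟨hτt, htT⟩
  have h2 := hS₀ k hk hk0 t ht
  rw [mul_assoc]
  exact h1.trans (mul_le_mul_of_nonneg_left h2 (Real.exp_pos _).le)

/-! ## `b₁`: the integral form of (6.123) -/

/-- Continuity of the `b₁`-source `R_b = (1+ε₀)^{5/2}(εa₁² + ε⁻¹K^{10}c₁²) + 4C₁δẼ₁^{1/2}`.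
[cite: Tao2016AveragedNS, §6.6 Prop. 6.13 (6.123)] -/
theorem RescaledHypotheses.continuousOn_source_b_one
    (h : RescaledHypotheses γ ε₀ K ε C₁ C₂ C₃ n₀ N τ Xr Er) {a b : ℝ} (ha : τ (n₀ - N) ≤ a) :
    ContinuousOn (fun s => (1 + ε₀) ^ ((5 : ℝ) / 2) * (ε * Xr 0 1 s ^ 2 + ε⁻¹ * K ^ 10 * Xr 2 1 s ^ 2) +
      4 * C₁ * (1 + ε₀) ^ (-(n₀ : ℝ) / 2) * Real.sqrt (Er 1 s)) (Icc a b) :=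
  (continuousOn_const.mul ((continuousOn_const.mul ((h.continuousOn_X 0 1 ha).pow 2)).add
    (continuousOn_const.mul ((h.continuousOn_X 2 1 ha).pow 2)))).add
    (continuousOn_const.mul (h.continuousOn_E 1 ha).sqrt)

/-- **(6.123), integral form**: `|b₁(t)| ≤ ∫_{τ₀}^t R_b` for `t ≥ τ₀` (recall `b₁(τ₀) = 0`), with
`R_b = (1+ε₀)^{5/2}(εa₁² + ε⁻¹K^{10}c₁²) + 4C₁(1+ε₀)^{-n₀/2}Ẽ₁^{1/2}`.
[cite: Tao2016AveragedNS, §6.6 Prop. 6.13 (6.123)] -/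
theorem RescaledHypotheses.abs_b_one_le_integral
    (h : RescaledHypotheses γ ε₀ K ε C₁ C₂ C₃ n₀ N τ Xr Er) (hε₀ : 0 < ε₀) (hε₀1 : ε₀ < 1)
    (hε : 0 < ε) (hC₁ : 0 ≤ C₁) (hN : n₀ ≤ N) {t : ℝ} (ht : τ (n₀ - N) ≤ t) :
    |Xr 1 1 t| ≤ ∫ s in (τ (n₀ - N))..t,
      ((1 + ε₀) ^ ((5 : ℝ) / 2) * (ε * Xr 0 1 s ^ 2 + ε⁻¹ * K ^ 10 * Xr 2 1 s ^ 2) +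
        4 * C₁ * (1 + ε₀) ^ (-(n₀ : ℝ) / 2) * Real.sqrt (Er 1 s)) := by
  have h0 : (0 : ℝ) < 1 + ε₀ := by linarith
  set Rb : ℝ → ℝ := fun s => (1 + ε₀) ^ ((5 : ℝ) / 2) * (ε * Xr 0 1 s ^ 2 + ε⁻¹ * K ^ 10 * Xr 2 1 s ^ 2) +
      4 * C₁ * (1 + ε₀) ^ (-(n₀ : ℝ) / 2) * Real.sqrt (Er 1 s) with hRb
  have hRc : ContinuousOn Rb (Icc (τ (n₀ - N)) t) := h.continuousOn_source_b_one le_rfl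
  have hR0 : ∀ s ∈ Icc (τ (n₀ - N)) t, 0 ≤ Rb s := fun s hs => by
    simp only [hRb]
    have hK10 : 0 ≤ K ^ 10 := by positivity
    positivity
  have hbound : ∀ s ∈ Ico (τ (n₀ - N)) t,
      |derivWithin (Xr 1 1) (Ici (τ (n₀ - N))) s - (fun _ => (0 : ℝ)) s * Xr 1 1 s| ≤ Rb s := by
    intro s hs
    simp only [zero_mul, sub_zero, hRb]
    have h1 := h.b_one_deriv_abs_le hε (by linarith) hs.1
    have h2 := err_weight_one_le Er n₀ hε₀ hε₀1.le hC₁ s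
    linarith
  have hmain := abs_le_linearComparison (h.continuousOn_X 1 1 le_rfl)
    (fun s hs => h.hasDeriv_X 1 1 hs.1) hRc hR0 continuousOn_const hbound (t := t) ⟨ht, le_rfl⟩
  have hinit : Xr 1 1 (τ (n₀ - N)) = 0 := h.init_Y 1 1 (by omega)
  simp only [abs_zero, intervalIntegral.integral_const, smul_eq_mul, mul_zero, Real.exp_zero,
    one_mul, hinit, zero_add] at hmain
  exact hmain

/-! ## The cumulative `c₁²` over the past -/

/-- **The cumulative square of `c₁` over the past**, uniformly in `N`: under the bootstrap bound on
`[τ₀, T]` and the past source level `S₀`, for `t ≤ T` in the `k`-th past interval,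
`∫_{τ₀}^t c₁² ≤ (e^{(6/100)K^{10}} S₀)² C₃ geomConst ε₀ (741/100) (1+ε₀)^{(741/100)k}`. (Proof: the
time-frozen extension `s ↦ c₁(min s t)` obeys the piecewise bound of `abs_c_one_past_le` on *every*
past interval, so the summation lemma `integral_past_le` applies with decay `2·(496/100) - 251/100`.)
[cite: Tao2016AveragedNS, §6.6 Prop. 6.13 (6.123)–(6.124)] -/
theorem RescaledHypotheses.integral_sq_c_one_past_le
    (h : RescaledHypotheses γ ε₀ K ε C₁ C₂ C₃ n₀ N τ Xr Er) (hε₀ : 0 < ε₀) (hε₀1 : ε₀ < 1)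
    (hε : 0 < ε) (hC₁ : 0 ≤ C₁) (hC₃ : 0 ≤ C₃) (hN : n₀ ≤ N) {T S₀ : ℝ} (hS₀0 : 0 ≤ S₀)
    (hΛ : ∀ t ∈ Icc (τ (n₀ - N)) T, ∫ s in (τ (n₀ - N))..t, |Xr 1 1 s| ≤ ε / 100)
    (hS₀ : ∀ k, n₀ - N < k → k ≤ 0 → ∀ t ∈ Icc (τ (k - 1)) (τ k),
      ∫ s in (τ (n₀ - N))..t, ((1 + ε₀) ^ ((5 : ℝ) / 2) * ε ^ 2 * Real.exp (-K ^ 10) * Xr 0 1 s ^ 2 +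
        4 * C₁ * (1 + ε₀) ^ (-(n₀ : ℝ) / 2) * Real.sqrt (Er 1 s)) ≤
        S₀ * (1 + ε₀) ^ ((496 : ℝ) / 100 * k))
    {k : ℤ} (hk : n₀ - N < k) (hk0 : k ≤ 0) {t : ℝ} (ht : t ∈ Icc (τ (k - 1)) (τ k)) (htT : t ≤ T) :
    ∫ s in (τ (n₀ - N))..t, Xr 2 1 s ^ 2 ≤
      (Real.exp (6 / 100 * K ^ 10) * S₀) ^ 2 * C₃ * geomConst ε₀ ((741 : ℝ) / 100) *
        (1 + ε₀) ^ ((741 : ℝ) / 100 * k) := by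
  have h0 : (0 : ℝ) < 1 + ε₀ := by linarith
  have hτt : τ (n₀ - N) ≤ t := (h.tau_init_le_tau (by omega) (by omega)).trans ht.1
  have htk : t ≤ τ k := ht.2
  have hk0' : τ k ≤ 0 := h.tau_le k (by omega) hk0
  have hτk : τ (n₀ - N) ≤ τ k := h.tau_init_le_tau (by omega) hk0
  -- the frozen extension
  set cf : ℝ → ℝ := fun s => Xr 2 1 (min s t) with hcf
  have hcfc : ContinuousOn cf (Icc (τ (n₀ - N)) 0) :=
    continuousOn_comp_min (b := t) (h.continuousOn_X 2 1 le_rfl) ⟨hτt, le_rfl⟩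
  set D : ℝ := Real.exp (6 / 100 * K ^ 10) * S₀ with hD
  have hD0 : 0 ≤ D := by positivity
  -- piecewise bound for `cf²` on every past interval
  have hbound : ∀ j, n₀ - N < j → j ≤ 0 → ∀ s ∈ Icc (τ (j - 1)) (τ j),
      cf s ^ 2 ≤ D ^ 2 * (1 + ε₀) ^ (((741 : ℝ) / 100 + (251 : ℝ) / 100) * j) := by
    intro j hj hj0 s hs
    have hexp : (1 + ε₀) ^ (((741 : ℝ) / 100 + (251 : ℝ) / 100) * j) =
        ((1 + ε₀) ^ ((496 : ℝ) / 100 * j)) ^ 2 := by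
      rw [← Real.rpow_natCast, ← Real.rpow_mul h0.le]; congr 1; push_cast; ring
    rw [hexp, ← mul_pow]
    have hcf_le : |cf s| ≤ D * (1 + ε₀) ^ ((496 : ℝ) / 100 * j) := by
      simp only [hcf]
      rcases le_or_gt s t with hst | hst
      · rw [min_eq_left hst]
        exact h.abs_c_one_past_le hε₀ hε₀1 hε hC₁ hN hΛ hS₀ hj hj0 hs (hst.trans htT)
      · rw [min_eq_right hst.le]
        have hkj : k ≤ j := h.piece_index_le hj hk0 hs ht hst
        calc |Xr 2 1 t| ≤ D * (1 + ε₀) ^ ((496 : ℝ) / 100 * k) :=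
              h.abs_c_one_past_le hε₀ hε₀1 hε hC₁ hN hΛ hS₀ hk hk0 ht htT
          _ ≤ D * (1 + ε₀) ^ ((496 : ℝ) / 100 * j) :=
              mul_le_mul_of_nonneg_left (rpow_scale_mono hε₀.le (by norm_num) hkj) hD0
    have hnn : 0 ≤ D * (1 + ε₀) ^ ((496 : ℝ) / 100 * j) := by positivity
    calc cf s ^ 2 = |cf s| ^ 2 := (sq_abs _).symm
      _ ≤ (D * (1 + ε₀) ^ ((496 : ℝ) / 100 * j)) ^ 2 := pow_le_pow_left₀ (abs_nonneg _) hcf_le 2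
  have hsum := h.integral_past_le hε₀ hC₃ (F := fun s => cf s ^ 2) (hcfc.pow 2) (D := D ^ 2)
    (s := (741 : ℝ) / 100) (by positivity) (by norm_num) hbound (k := k) (by omega) hk0
  -- `∫_{τ₀}^t c₁² = ∫_{τ₀}^t cf² ≤ ∫_{τ₀}^{τ_k} cf²`
  have heq : ∫ s in (τ (n₀ - N))..t, Xr 2 1 s ^ 2 = ∫ s in (τ (n₀ - N))..t, cf s ^ 2 := by
    apply integral_congr
    intro s hs
    rw [uIcc_of_le hτt] at hs
    simp only [hcf, min_eq_left hs.2]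
  have hmono : ∫ s in (τ (n₀ - N))..t, cf s ^ 2 ≤ ∫ s in (τ (n₀ - N))..(τ k), cf s ^ 2 := by
    apply integral_mono_interval le_rfl hτt htk
    · exact ae_restrict_of_forall_mem measurableSet_Ioc fun s _ => sq_nonneg _
    · exact ((hcfc.pow 2).mono (Icc_subset_Icc le_rfl hk0')).intervalIntegrable_of_Icc hτk
  rw [heq]
  calc ∫ s in (τ (n₀ - N))..t, cf s ^ 2 ≤ ∫ s in (τ (n₀ - N))..(τ k), cf s ^ 2 := hmono
    _ ≤ D ^ 2 * C₃ * geomConst ε₀ ((741 : ℝ) / 100) * (1 + ε₀) ^ ((741 : ℝ) / 100 * k) := hsum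

/-! ## `b₁` on the past intervals: (6.123)–(6.124) repaired -/

/-- **(6.123)–(6.124), repaired: the `b₁`-source over the past.** Under the bootstrap bound on
`[τ₀, T]`, the past source level `S₀`, and the improved-decay condition `hκ`, for `t ≤ T` in the
`k`-th past interval: `∫_{τ₀}^t R_b ≤ D_b (1+ε₀)^{(496/100)k}` with
`D_b = 12εK^{-30}C₃G_{747} + 6ε⁻¹K^{10}(e^{(6/100)K^{10}}S₀)²C₃G_{741} + 4C₁(1+ε₀)^{-n₀/2} Ξ C₃ G_{496}`
(`G_s = geomConst ε₀ s`, `Ξ = e·6√2K·cumEnergyConst ε₀ C₃`). All three rates `747/100`, `741/100`,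
`496/100` exceed `251/100`, which makes `∫|b₁|` over the past bounded uniformly in `N`
(`rotorPhase_past_le`). [cite: Tao2016AveragedNS, §6.6 Prop. 6.13 (6.123)–(6.124)] -/
theorem RescaledHypotheses.integral_source_b_one_past_le
    (h : RescaledHypotheses γ ε₀ K ε C₁ C₂ C₃ n₀ N τ Xr Er) (hε₀ : 0 < ε₀) (hε₀1 : ε₀ < 1)
    (hK : 1 ≤ K) (hε : 0 < ε) (hC₁ : 0 ≤ C₁) (hC₃ : 0 ≤ C₃) (hN : n₀ ≤ N) {T S₀ : ℝ} (hS₀0 : 0 ≤ S₀)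
    (hκ : 36 * Real.sqrt 2 * K * ((K ^ 15)⁻¹ * (1 + ε₀) ^ (-(999 : ℝ) / 100) * C₃ *
      geomConst ε₀ ((248 : ℝ) / 100)) ≤ 1)
    (hΛ : ∀ t ∈ Icc (τ (n₀ - N)) T, ∫ s in (τ (n₀ - N))..t, |Xr 1 1 s| ≤ ε / 100)
    (hS₀ : ∀ k, n₀ - N < k → k ≤ 0 → ∀ t ∈ Icc (τ (k - 1)) (τ k),
      ∫ s in (τ (n₀ - N))..t, ((1 + ε₀) ^ ((5 : ℝ) / 2) * ε ^ 2 * Real.exp (-K ^ 10) * Xr 0 1 s ^ 2 +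
        4 * C₁ * (1 + ε₀) ^ (-(n₀ : ℝ) / 2) * Real.sqrt (Er 1 s)) ≤
        S₀ * (1 + ε₀) ^ ((496 : ℝ) / 100 * k))
    {k : ℤ} (hk : n₀ - N < k) (hk0 : k ≤ 0) {t : ℝ} (ht : t ∈ Icc (τ (k - 1)) (τ k)) (htT : t ≤ T) :
    ∫ s in (τ (n₀ - N))..t,
      ((1 + ε₀) ^ ((5 : ℝ) / 2) * (ε * Xr 0 1 s ^ 2 + ε⁻¹ * K ^ 10 * Xr 2 1 s ^ 2) +
        4 * C₁ * (1 + ε₀) ^ (-(n₀ : ℝ) / 2) * Real.sqrt (Er 1 s)) ≤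
      (12 * ε * ((K ^ 30)⁻¹ * C₃ * geomConst ε₀ ((747 : ℝ) / 100)) +
        6 * ε⁻¹ * K ^ 10 * ((Real.exp (6 / 100 * K ^ 10) * S₀) ^ 2 * C₃ * geomConst ε₀ ((741 : ℝ) / 100)) +
        4 * C₁ * (1 + ε₀) ^ (-(n₀ : ℝ) / 2) *
          (Real.exp 1 * (6 * Real.sqrt 2 * K) * cumEnergyConst ε₀ C₃ * C₃ * geomConst ε₀ ((496 : ℝ) / 100))) *
      (1 + ε₀) ^ ((496 : ℝ) / 100 * k) := by
  have h0 : (0 : ℝ) < 1 + ε₀ := by linarith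
  have hKpos : 0 < K := by linarith
  have hq6 : (1 + ε₀) ^ ((5 : ℝ) / 2) ≤ 6 := rpow_five_halves_le_six h0.le (by linarith)
  have hτt : τ (n₀ - N) ≤ t := (h.tau_init_le_tau (by omega) (by omega)).trans ht.1
  have htk : t ≤ τ k := ht.2
  have hk0' : τ k ≤ 0 := h.tau_le k (by omega) hk0
  have hτk : τ (n₀ - N) ≤ τ k := h.tau_init_le_tau (by omega) hk0
  set Ξ := Real.exp 1 * (6 * Real.sqrt 2 * K) * cumEnergyConst ε₀ C₃ with hΞ
  have hΞ0 : 0 ≤ Ξ := by have := cumEnergyConst_nonneg hε₀ hC₃; positivity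
  set G747 := (K ^ 30)⁻¹ * C₃ * geomConst ε₀ ((747 : ℝ) / 100) with hG747
  have hG747nn : 0 ≤ G747 := by
    have := geomConst_pos hε₀ (s := (747 : ℝ) / 100) (by norm_num); positivity
  -- split the integral into its three pieces
  have hc1 : ContinuousOn (fun s => Xr 0 1 s ^ 2) (Icc (τ (n₀ - N)) (τ k)) :=
    (h.continuousOn_X 0 1 le_rfl).pow 2
  have hc2 : ContinuousOn (fun s => Xr 2 1 s ^ 2) (Icc (τ (n₀ - N)) (τ k)) :=
    (h.continuousOn_X 2 1 le_rfl).pow 2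
  have hc3 : ContinuousOn (fun s => Real.sqrt (Er 1 s)) (Icc (τ (n₀ - N)) (τ k)) :=
    (h.continuousOn_E 1 le_rfl).sqrt
  have hi1 : IntervalIntegrable (fun s => Xr 0 1 s ^ 2) volume (τ (n₀ - N)) t :=
    (hc1.mono (Icc_subset_Icc le_rfl htk)).intervalIntegrable_of_Icc hτt
  have hi2 : IntervalIntegrable (fun s => Xr 2 1 s ^ 2) volume (τ (n₀ - N)) t :=
    (hc2.mono (Icc_subset_Icc le_rfl htk)).intervalIntegrable_of_Icc hτt
  have hi3 : IntervalIntegrable (fun s => Real.sqrt (Er 1 s)) volume (τ (n₀ - N)) t :=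
    (hc3.mono (Icc_subset_Icc le_rfl htk)).intervalIntegrable_of_Icc hτt
  have hsplit : ∫ s in (τ (n₀ - N))..t,
      ((1 + ε₀) ^ ((5 : ℝ) / 2) * (ε * Xr 0 1 s ^ 2 + ε⁻¹ * K ^ 10 * Xr 2 1 s ^ 2) +
        4 * C₁ * (1 + ε₀) ^ (-(n₀ : ℝ) / 2) * Real.sqrt (Er 1 s)) =
      (1 + ε₀) ^ ((5 : ℝ) / 2) * ε * (∫ s in (τ (n₀ - N))..t, Xr 0 1 s ^ 2) +
      (1 + ε₀) ^ ((5 : ℝ) / 2) * (ε⁻¹ * K ^ 10) * (∫ s in (τ (n₀ - N))..t, Xr 2 1 s ^ 2) +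
      4 * C₁ * (1 + ε₀) ^ (-(n₀ : ℝ) / 2) * (∫ s in (τ (n₀ - N))..t, Real.sqrt (Er 1 s)) := by
    have e1 : (fun s => (1 + ε₀) ^ ((5 : ℝ) / 2) * (ε * Xr 0 1 s ^ 2 + ε⁻¹ * K ^ 10 * Xr 2 1 s ^ 2) +
        4 * C₁ * (1 + ε₀) ^ (-(n₀ : ℝ) / 2) * Real.sqrt (Er 1 s)) =
        fun s => ((1 + ε₀) ^ ((5 : ℝ) / 2) * ε * Xr 0 1 s ^ 2 +
          (1 + ε₀) ^ ((5 : ℝ) / 2) * (ε⁻¹ * K ^ 10) * Xr 2 1 s ^ 2) +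
          4 * C₁ * (1 + ε₀) ^ (-(n₀ : ℝ) / 2) * Real.sqrt (Er 1 s) := by
      ext s; ring
    rw [e1, intervalIntegral.integral_add ((hi1.const_mul _).add (hi2.const_mul _)) (hi3.const_mul _),
      intervalIntegral.integral_add (hi1.const_mul _) (hi2.const_mul _),
      intervalIntegral.integral_const_mul, intervalIntegral.integral_const_mul,
      intervalIntegral.integral_const_mul]
  rw [hsplit]
  -- piece 1: `∫ a₁² ≤ 2 K^{-30} C₃ G747 q^{(747/100)k} ≤ 2 G747 q^{(496/100)k}`
  have hP1 : ∫ s in (τ (n₀ - N))..t, Xr 0 1 s ^ 2 ≤ 2 * G747 * (1 + ε₀) ^ ((496 : ℝ) / 100 * k) := by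
    have hm : ∫ s in (τ (n₀ - N))..t, Xr 0 1 s ^ 2 ≤ ∫ s in (τ (n₀ - N))..t, 2 * Er 1 s :=
      integral_mono_on hτt hi1 (((h.continuousOn_E 1 le_rfl).mono
        (Icc_subset_Icc le_rfl (htk.trans hk0'))).intervalIntegrable_of_Icc hτt |>.const_mul 2)
        fun s hs => h.sq_le_two_mul_energy 0 1 hs.1
    have hm2 : ∫ s in (τ (n₀ - N))..t, 2 * Er 1 s ≤ ∫ s in (τ (n₀ - N))..(τ k), 2 * Er 1 s := by
      apply integral_mono_interval le_rfl hτt htk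
      · exact ae_restrict_of_forall_mem measurableSet_Ioc fun s hs => by
          have := h.nonneg_F 1 s hs.1.le; positivity
      · exact ((h.continuousOn_E 1 le_rfl).mono
          (Icc_subset_Icc le_rfl hk0')).intervalIntegrable_of_Icc hτk |>.const_mul 2
    have hm3 := h.integral_energy_one_past_le hε₀ hKpos hC₃ (k := k) (by omega) hk0
    simp only [intervalIntegral.integral_const_mul] at hm hm2
    have hdec : (1 + ε₀) ^ ((747 : ℝ) / 100 * k) ≤ (1 + ε₀) ^ ((496 : ℝ) / 100 * k) :=
      rpow_rate_mono hε₀.le (by norm_num) hk0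
    have := mul_le_mul_of_nonneg_left hdec hG747nn
    simp only [hG747] at this ⊢
    linarith
  -- piece 2: `∫ c₁² ≤ D² C₃ G741 q^{(741/100)k} ≤ D² C₃ G741 q^{(496/100)k}`
  have hP2 : ∫ s in (τ (n₀ - N))..t, Xr 2 1 s ^ 2 ≤
      (Real.exp (6 / 100 * K ^ 10) * S₀) ^ 2 * C₃ * geomConst ε₀ ((741 : ℝ) / 100) *
        (1 + ε₀) ^ ((496 : ℝ) / 100 * k) := by
    have h1 := h.integral_sq_c_one_past_le hε₀ hε₀1 hε hC₁ hC₃ hN hS₀0 hΛ hS₀ hk hk0 ht htT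
    have hdec : (1 + ε₀) ^ ((741 : ℝ) / 100 * k) ≤ (1 + ε₀) ^ ((496 : ℝ) / 100 * k) :=
      rpow_rate_mono hε₀.le (by norm_num) hk0
    have hnn : 0 ≤ (Real.exp (6 / 100 * K ^ 10) * S₀) ^ 2 * C₃ * geomConst ε₀ ((741 : ℝ) / 100) := by
      have := geomConst_pos hε₀ (s := (741 : ℝ) / 100) (by norm_num); positivity
    exact h1.trans (mul_le_mul_of_nonneg_left hdec hnn)
  -- piece 3: `∫ √Ẽ₁ ≤ Ξ C₃ G496 q^{(496/100)k}`
  have hP3 : ∫ s in (τ (n₀ - N))..t, Real.sqrt (Er 1 s) ≤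
      Ξ * C₃ * geomConst ε₀ ((496 : ℝ) / 100) * (1 + ε₀) ^ ((496 : ℝ) / 100 * k) := by
    have hm2 : ∫ s in (τ (n₀ - N))..t, Real.sqrt (Er 1 s) ≤ ∫ s in (τ (n₀ - N))..(τ k), Real.sqrt (Er 1 s) := by
      apply integral_mono_interval le_rfl hτt htk
      · exact ae_restrict_of_forall_mem measurableSet_Ioc fun s _ => Real.sqrt_nonneg _
      · exact (hc3.mono (Icc_subset_Icc le_rfl le_rfl)).intervalIntegrable_of_Icc hτk
    have hm3 := h.integral_past_le hε₀ hC₃ ((h.continuousOn_E 1 le_rfl).sqrt) (D := Ξ)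
      (s := (496 : ℝ) / 100) hΞ0 (by norm_num) (fun j hj hj0 s hs => by
        have := h.sqrt_energy_one_past_le_improved hε₀ hε₀1 hK hC₃ hκ hj hj0 hs
        convert this using 2; norm_num) (k := k) (by omega) hk0
    exact hm2.trans hm3
  have hA1 : 0 ≤ (1 + ε₀) ^ ((5 : ℝ) / 2) * ε := by positivity
  have hA2 : 0 ≤ (1 + ε₀) ^ ((5 : ℝ) / 2) * (ε⁻¹ * K ^ 10) := by positivity
  have hA3 : 0 ≤ 4 * C₁ * (1 + ε₀) ^ (-(n₀ : ℝ) / 2) := by positivity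
  have hq : 0 ≤ (1 + ε₀) ^ ((496 : ℝ) / 100 * k) := (Real.rpow_pos_of_pos h0 _).le
  have hD2nn : 0 ≤ (Real.exp (6 / 100 * K ^ 10) * S₀) ^ 2 * C₃ * geomConst ε₀ ((741 : ℝ) / 100) *
      (1 + ε₀) ^ ((496 : ℝ) / 100 * k) := by
    have := geomConst_pos hε₀ (s := (741 : ℝ) / 100) (by norm_num); positivity
  have hG496nn : 0 ≤ Ξ * C₃ * geomConst ε₀ ((496 : ℝ) / 100) * (1 + ε₀) ^ ((496 : ℝ) / 100 * k) := by
    have := geomConst_pos hε₀ (s := (496 : ℝ) / 100) (by norm_num); positivity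
  calc (1 + ε₀) ^ ((5 : ℝ) / 2) * ε * (∫ s in (τ (n₀ - N))..t, Xr 0 1 s ^ 2) +
        (1 + ε₀) ^ ((5 : ℝ) / 2) * (ε⁻¹ * K ^ 10) * (∫ s in (τ (n₀ - N))..t, Xr 2 1 s ^ 2) +
        4 * C₁ * (1 + ε₀) ^ (-(n₀ : ℝ) / 2) * (∫ s in (τ (n₀ - N))..t, Real.sqrt (Er 1 s))
      ≤ (1 + ε₀) ^ ((5 : ℝ) / 2) * ε * (2 * G747 * (1 + ε₀) ^ ((496 : ℝ) / 100 * k)) +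
        (1 + ε₀) ^ ((5 : ℝ) / 2) * (ε⁻¹ * K ^ 10) *
          ((Real.exp (6 / 100 * K ^ 10) * S₀) ^ 2 * C₃ * geomConst ε₀ ((741 : ℝ) / 100) *
            (1 + ε₀) ^ ((496 : ℝ) / 100 * k)) +
        4 * C₁ * (1 + ε₀) ^ (-(n₀ : ℝ) / 2) *
          (Ξ * C₃ * geomConst ε₀ ((496 : ℝ) / 100) * (1 + ε₀) ^ ((496 : ℝ) / 100 * k)) := by
        gcongr
    _ ≤ 6 * ε * (2 * G747 * (1 + ε₀) ^ ((496 : ℝ) / 100 * k)) +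
        6 * (ε⁻¹ * K ^ 10) *
          ((Real.exp (6 / 100 * K ^ 10) * S₀) ^ 2 * C₃ * geomConst ε₀ ((741 : ℝ) / 100) *
            (1 + ε₀) ^ ((496 : ℝ) / 100 * k)) +
        4 * C₁ * (1 + ε₀) ^ (-(n₀ : ℝ) / 2) *
          (Ξ * C₃ * geomConst ε₀ ((496 : ℝ) / 100) * (1 + ε₀) ^ ((496 : ℝ) / 100 * k)) := by
        have e1 : (1 + ε₀) ^ ((5 : ℝ) / 2) * ε * (2 * G747 * (1 + ε₀) ^ ((496 : ℝ) / 100 * k)) ≤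
            6 * ε * (2 * G747 * (1 + ε₀) ^ ((496 : ℝ) / 100 * k)) := by
          apply mul_le_mul_of_nonneg_right (mul_le_mul_of_nonneg_right hq6 hε.le)
          positivity
        have e2 : (1 + ε₀) ^ ((5 : ℝ) / 2) * (ε⁻¹ * K ^ 10) *
            ((Real.exp (6 / 100 * K ^ 10) * S₀) ^ 2 * C₃ * geomConst ε₀ ((741 : ℝ) / 100) *
              (1 + ε₀) ^ ((496 : ℝ) / 100 * k)) ≤ 6 * (ε⁻¹ * K ^ 10) *
            ((Real.exp (6 / 100 * K ^ 10) * S₀) ^ 2 * C₃ * geomConst ε₀ ((741 : ℝ) / 100) *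
              (1 + ε₀) ^ ((496 : ℝ) / 100 * k)) :=
          mul_le_mul_of_nonneg_right (mul_le_mul_of_nonneg_right hq6 (by positivity)) hD2nn
        linarith
    _ = _ := by simp only [hG747, hΞ]; ring

/-- **`b₁` on the `k`-th past interval**: `|b₁(t)| ≤ D_b (1+ε₀)^{(496/100)k}` (corollary of
`abs_b_one_le_integral` and `integral_source_b_one_past_le`).
[cite: Tao2016AveragedNS, §6.6 Prop. 6.13 (6.123)–(6.124)] -/
theorem RescaledHypotheses.abs_b_one_past_le
    (h : RescaledHypotheses γ ε₀ K ε C₁ C₂ C₃ n₀ N τ Xr Er) (hε₀ : 0 < ε₀) (hε₀1 : ε₀ < 1)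
    (hK : 1 ≤ K) (hε : 0 < ε) (hC₁ : 0 ≤ C₁) (hC₃ : 0 ≤ C₃) (hN : n₀ ≤ N) {T S₀ : ℝ} (hS₀0 : 0 ≤ S₀)
    (hκ : 36 * Real.sqrt 2 * K * ((K ^ 15)⁻¹ * (1 + ε₀) ^ (-(999 : ℝ) / 100) * C₃ *
      geomConst ε₀ ((248 : ℝ) / 100)) ≤ 1)
    (hΛ : ∀ t ∈ Icc (τ (n₀ - N)) T, ∫ s in (τ (n₀ - N))..t, |Xr 1 1 s| ≤ ε / 100)
    (hS₀ : ∀ k, n₀ - N < k → k ≤ 0 → ∀ t ∈ Icc (τ (k - 1)) (τ k),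
      ∫ s in (τ (n₀ - N))..t, ((1 + ε₀) ^ ((5 : ℝ) / 2) * ε ^ 2 * Real.exp (-K ^ 10) * Xr 0 1 s ^ 2 +
        4 * C₁ * (1 + ε₀) ^ (-(n₀ : ℝ) / 2) * Real.sqrt (Er 1 s)) ≤
        S₀ * (1 + ε₀) ^ ((496 : ℝ) / 100 * k))
    {k : ℤ} (hk : n₀ - N < k) (hk0 : k ≤ 0) {t : ℝ} (ht : t ∈ Icc (τ (k - 1)) (τ k)) (htT : t ≤ T) :
    |Xr 1 1 t| ≤
      (12 * ε * ((K ^ 30)⁻¹ * C₃ * geomConst ε₀ ((747 : ℝ) / 100)) +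
        6 * ε⁻¹ * K ^ 10 * ((Real.exp (6 / 100 * K ^ 10) * S₀) ^ 2 * C₃ * geomConst ε₀ ((741 : ℝ) / 100)) +
        4 * C₁ * (1 + ε₀) ^ (-(n₀ : ℝ) / 2) *
          (Real.exp 1 * (6 * Real.sqrt 2 * K) * cumEnergyConst ε₀ C₃ * C₃ * geomConst ε₀ ((496 : ℝ) / 100))) *
      (1 + ε₀) ^ ((496 : ℝ) / 100 * k) :=
  (h.abs_b_one_le_integral hε₀ hε₀1 hε hC₁ hN
    ((h.tau_init_le_tau (by omega) (by omega)).trans ht.1)).trans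
    (h.integral_source_b_one_past_le hε₀ hε₀1 hK hε hC₁ hC₃ hN hS₀0 hκ hΛ hS₀ hk hk0 ht htT)

/-! ## The rotor phase over the past -/

/-- **The rotor phase over the past is `O(εK^{-30}C₃²)` uniformly in `N`.** Under the bootstrap
bound on `[τ₀, T]` and the past source level `S₀`, for a past time `t ≤ min(T, 0)` (`t ∈ [τ₀, 0]`,
`n₀ < N`): `Λ(t) = ∫_{τ₀}^t |b₁| ≤ D_b C₃ geomConst ε₀ (245/100)`, with `D_b` the constant of
`abs_b_one_past_le`. (Proof: time-frozen extension of `|b₁|` and `integral_past_le` with decay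
`496/100 - 251/100`.) [cite: Tao2016AveragedNS, §6.6 Prop. 6.13 (6.121), (6.124)] -/
theorem RescaledHypotheses.rotorPhase_past_le
    (h : RescaledHypotheses γ ε₀ K ε C₁ C₂ C₃ n₀ N τ Xr Er) (hε₀ : 0 < ε₀) (hε₀1 : ε₀ < 1)
    (hK : 1 ≤ K) (hε : 0 < ε) (hC₁ : 0 ≤ C₁) (hC₃ : 0 ≤ C₃) (hN : n₀ < N) {T S₀ : ℝ} (hS₀0 : 0 ≤ S₀)
    (hκ : 36 * Real.sqrt 2 * K * ((K ^ 15)⁻¹ * (1 + ε₀) ^ (-(999 : ℝ) / 100) * C₃ *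
      geomConst ε₀ ((248 : ℝ) / 100)) ≤ 1)
    (hΛ : ∀ t ∈ Icc (τ (n₀ - N)) T, ∫ s in (τ (n₀ - N))..t, |Xr 1 1 s| ≤ ε / 100)
    (hS₀ : ∀ k, n₀ - N < k → k ≤ 0 → ∀ t ∈ Icc (τ (k - 1)) (τ k),
      ∫ s in (τ (n₀ - N))..t, ((1 + ε₀) ^ ((5 : ℝ) / 2) * ε ^ 2 * Real.exp (-K ^ 10) * Xr 0 1 s ^ 2 +
        4 * C₁ * (1 + ε₀) ^ (-(n₀ : ℝ) / 2) * Real.sqrt (Er 1 s)) ≤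
        S₀ * (1 + ε₀) ^ ((496 : ℝ) / 100 * k))
    {t : ℝ} (ht : t ∈ Icc (τ (n₀ - N)) 0) (htT : t ≤ T) :
    ∫ s in (τ (n₀ - N))..t, |Xr 1 1 s| ≤
      (12 * ε * ((K ^ 30)⁻¹ * C₃ * geomConst ε₀ ((747 : ℝ) / 100)) +
        6 * ε⁻¹ * K ^ 10 * ((Real.exp (6 / 100 * K ^ 10) * S₀) ^ 2 * C₃ * geomConst ε₀ ((741 : ℝ) / 100)) +
        4 * C₁ * (1 + ε₀) ^ (-(n₀ : ℝ) / 2) *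
          (Real.exp 1 * (6 * Real.sqrt 2 * K) * cumEnergyConst ε₀ C₃ * C₃ * geomConst ε₀ ((496 : ℝ) / 100))) *
      C₃ * geomConst ε₀ ((245 : ℝ) / 100) := by
  have h0 : (0 : ℝ) < 1 + ε₀ := by linarith
  obtain ⟨k, hk, hk0, htk⟩ := h.exists_piece hN ht
  have hτt : τ (n₀ - N) ≤ t := ht.1
  have hk0' : τ k ≤ 0 := h.tau_le k (by omega) hk0
  have hτk : τ (n₀ - N) ≤ τ k := h.tau_init_le_tau (by omega) hk0
  set Db : ℝ := 12 * ε * ((K ^ 30)⁻¹ * C₃ * geomConst ε₀ ((747 : ℝ) / 100)) +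
        6 * ε⁻¹ * K ^ 10 * ((Real.exp (6 / 100 * K ^ 10) * S₀) ^ 2 * C₃ * geomConst ε₀ ((741 : ℝ) / 100)) +
        4 * C₁ * (1 + ε₀) ^ (-(n₀ : ℝ) / 2) *
          (Real.exp 1 * (6 * Real.sqrt 2 * K) * cumEnergyConst ε₀ C₃ * C₃ * geomConst ε₀ ((496 : ℝ) / 100))
    with hDb
  have hDb0 : 0 ≤ Db := by
    have := geomConst_pos hε₀ (s := (747 : ℝ) / 100) (by norm_num)
    have := geomConst_pos hε₀ (s := (741 : ℝ) / 100) (by norm_num)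
    have := geomConst_pos hε₀ (s := (496 : ℝ) / 100) (by norm_num)
    have := cumEnergyConst_nonneg hε₀ hC₃
    have hKpos : 0 < K := by linarith
    have hK10 : 0 ≤ K ^ 10 := by positivity
    positivity
  -- frozen extension of `|b₁|`
  set bf : ℝ → ℝ := fun s => |Xr 1 1 (min s t)| with hbf
  have hbfc : ContinuousOn bf (Icc (τ (n₀ - N)) 0) :=
    (continuousOn_comp_min (b := t) (h.continuousOn_X 1 1 le_rfl) ⟨hτt, le_rfl⟩).abs
  have hbound : ∀ j, n₀ - N < j → j ≤ 0 → ∀ s ∈ Icc (τ (j - 1)) (τ j),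
      bf s ≤ Db * (1 + ε₀) ^ (((245 : ℝ) / 100 + (251 : ℝ) / 100) * j) := by
    intro j hj hj0 s hs
    have hexp : ((245 : ℝ) / 100 + (251 : ℝ) / 100) * j = (496 : ℝ) / 100 * j := by ring
    rw [hexp]
    simp only [hbf]
    rcases le_or_gt s t with hst | hst
    · rw [min_eq_left hst]
      exact h.abs_b_one_past_le hε₀ hε₀1 hK hε hC₁ hC₃ hN.le hS₀0 hκ hΛ hS₀ hj hj0 hs (hst.trans htT)
    · rw [min_eq_right hst.le]
      have hkj : k ≤ j := h.piece_index_le hj hk0 hs htk hst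
      calc |Xr 1 1 t| ≤ Db * (1 + ε₀) ^ ((496 : ℝ) / 100 * k) :=
            h.abs_b_one_past_le hε₀ hε₀1 hK hε hC₁ hC₃ hN.le hS₀0 hκ hΛ hS₀ hk hk0 htk htT
        _ ≤ Db * (1 + ε₀) ^ ((496 : ℝ) / 100 * j) :=
            mul_le_mul_of_nonneg_left (rpow_scale_mono hε₀.le (by norm_num) hkj) hDb0
  have hsum := h.integral_past_le hε₀ hC₃ (F := bf) hbfc (D := Db) (s := (245 : ℝ) / 100) hDb0
    (by norm_num) hbound (k := k) (by omega) hk0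
  have heq : ∫ s in (τ (n₀ - N))..t, |Xr 1 1 s| = ∫ s in (τ (n₀ - N))..t, bf s := by
    apply integral_congr
    intro s hs
    rw [uIcc_of_le hτt] at hs
    simp only [hbf, min_eq_left hs.2]
  have hmono : ∫ s in (τ (n₀ - N))..t, bf s ≤ ∫ s in (τ (n₀ - N))..(τ k), bf s := by
    apply integral_mono_interval le_rfl hτt htk.2
    · exact ae_restrict_of_forall_mem measurableSet_Ioc fun s _ => abs_nonneg _
    · exact (hbfc.mono (Icc_subset_Icc le_rfl hk0')).intervalIntegrable_of_Icc hτk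
  have hq1 : (1 + ε₀) ^ ((245 : ℝ) / 100 * k) ≤ 1 := by
    apply Real.rpow_le_one_of_one_le_of_nonpos (by linarith)
    have : (k : ℝ) ≤ 0 := by exact_mod_cast hk0
    nlinarith
  have hG : 0 ≤ Db * C₃ * geomConst ε₀ ((245 : ℝ) / 100) := by
    have := geomConst_pos hε₀ (s := (245 : ℝ) / 100) (by norm_num); positivity
  rw [heq]
  calc ∫ s in (τ (n₀ - N))..t, bf s ≤ ∫ s in (τ (n₀ - N))..(τ k), bf s := hmono
    _ ≤ Db * C₃ * geomConst ε₀ ((245 : ℝ) / 100) * (1 + ε₀) ^ ((245 : ℝ) / 100 * k) := hsum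
    _ ≤ Db * C₃ * geomConst ε₀ ((245 : ℝ) / 100) * 1 := mul_le_mul_of_nonneg_left hq1 hG
    _ = _ := by rw [mul_one]

end Past

end TaoCascade

end Literature.Analysis.FluidPDE
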